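import Summits.Ventures.Crystal3D.Theorems.StickyWulffConstantTextureLiminfTexShadowDefs

/-!
# `PolycrystalWulffBound` / `TexShadow`: the prism `facetArea` does not depend on the side of the normal

Route `StickyWulffConstant` of the venture `Summits/Ventures/Crystal3D`, cruxes `PolycrystalWulffBound`
(stmt-Ventures-19482) and `TextureLiminf` (stmt-Ventures-19483).  Clause (B) of `PolytopeCalculus`
charges a common facet `cl Q_i ∩ cl Q_j` with `(h_K(ν i j) + h_K(−ν i j)) · facetArea (…) (ν i j)`
for a CHOSEN unit normal `ν i j`; re-indexing a family of cells (as every consumer of the arrangement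
refinement must) may flip that choice.  The two one-line symmetries that make the cross term
orientation-free:

* `prism_neg_eq_vadd` / `facetArea_neg` — the unit prism over `F` in direction `−ν` is the translate
  by `−ν` of the prism in direction `ν`, so `facetArea F (−ν) = facetArea F ν` (ANY set `F`, any `ν`;
  translation invariance of Lebesgue measure — no planarity needed);
* `crossTerm_neg` — packaged with `h_K(−ν) + h_K(ν) = h_K(ν) + h_K(−ν)`: the whole cross term
  `(h_K(ν) + h_K(−ν)) · facetArea F ν` is invariant under `ν ↦ −ν`.
WHAT THIS IS NOT: anything on the cruxes beyond bookkeeping.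
-/

noncomputable section

namespace Summit.Ventures.Crystal3D.Theorems

open MeasureTheory Set
open scoped RealInnerProductSpace ENNReal Pointwise
open Summit.Ventures.Crystal3D.Cruxes.TextureLiminf.TexShadow

/-- The prism over `F` in direction `−ν` is the `−ν`-translate of the prism in direction `ν`. -/
theorem prism_neg_eq_vadd (F : Set E3) (ν : E3) :
    {x : E3 | ∃ y ∈ F, ∃ t ∈ Set.Icc (0 : ℝ) 1, x = y + t • (-ν)} =
      (-ν) +ᵥ {x : E3 | ∃ y ∈ F, ∃ t ∈ Set.Icc (0 : ℝ) 1, x = y + t • ν} := by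
  ext x
  rw [Set.mem_vadd_set]
  simp only [mem_setOf_eq, vadd_eq_add]
  constructor
  · rintro ⟨y, hy, t, ht, rfl⟩
    refine ⟨y + (1 - t) • ν, ⟨y, hy, 1 - t, ⟨by linarith [ht.2], by linarith [ht.1]⟩, rfl⟩, ?_⟩
    rw [smul_neg, sub_smul, one_smul]
    abel
  · rintro ⟨z, ⟨y, hy, s, hs, rfl⟩, rfl⟩
    refine ⟨y, hy, 1 - s, ⟨by linarith [hs.2], by linarith [hs.1]⟩, ?_⟩
    rw [smul_neg, sub_smul, one_smul]
    abel

/-- **`facetArea F (−ν) = facetArea F ν`** for every set `F` and vector `ν` (translation invariance). -/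
theorem facetArea_neg (F : Set E3) (ν : E3) : facetArea F (-ν) = facetArea F ν := by
  unfold facetArea
  rw [prism_neg_eq_vadd, measure_vadd]

/-- The cross term of clause (B) is orientation-free:
`(h_K(−ν) + h_K(ν)) · facetArea F (−ν) = (h_K(ν) + h_K(−ν)) · facetArea F ν`. -/
theorem crossTerm_neg (K : Set E3) (F : Set E3) (ν : E3) :
    (supportFn K (-ν) + supportFn K (- -ν)) * facetArea F (-ν) =
      (supportFn K ν + supportFn K (-ν)) * facetArea F ν := by
  rw [neg_neg, facetArea_neg, add_comm]

end Summit.Ventures.Crystal3D.Theorems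

end
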